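import Summits.Ventures.CertifiedArithmetic.LowPrec.DoubleRoundingThreshold

/-!
# Theorem D-dr, clause (T), for every pair of format records: the threshold is necessary

HONEST FRAMING (venture CertifiedArithmetic / cell `pub-lowprec`): certified error envelopes and
provably optimal rounding/accumulation schemes for low-precision formats under stated cost models;
every table by two implementations; no hardware or vendor claims.

Completes clause (T) of THEOREM D-dr (`DoubleRoundingMatrix.lean`) as a theorem about ARBITRARY
format records: with `P = P_X ≥ 2`, `q = P_Y`, `P < q ≤ 2P`, `F_X ⊆ F_Y` (`embedsTest`) and
`M = maxScaled X`,
  `DRAdd X Y ↔ M < drThreshold X Y`            (`drAdd_iff_lt_threshold`),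
i.e. `↔ drAddTest X Y` on this strip (`drAdd_iff_test_of_lt`); with clauses (S) and (W) of
`DoubleRoundingDecision.lean`, `DRAdd X Y ↔ drAddTest X Y` for EVERY embedded pair of records with
`P ≥ 2` and `bias_X ≤ bias_Y` (`drAdd_iff_test_of_embedsTest`; the bias enters only through (W)),
and the embedding hypothesis cannot be dropped (`phantom_drAdd_not_test`, §3). Sufficiency is
`DoubleRoundingThreshold.lean`; THIS FILE is necessity, `not_drAdd_of_threshold_le`: whenever
`drThreshold X Y ≤ M`, the witness operands of the named matrix (`drWitA`, `drWitB`) exist in `X`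
and fail, for every record. Both regimes of the threshold are ONE configuration
(`roundNE_roundNE_ne_above_midpoint`), `k + 1` binades above the unit binade of `X`
(`k = q₁ - P` in the regime `q₁ ≤ 2P - 1`, operands `a = 2^(P+k)`, `b = 2^k + 1`; `k = P` in the
regime `q₁ = 2P`, operands `a = 2^(2P) + 2^(P+1)`, `b = -(2^P - 1)`), in quanta of `X`:
* the sum is `t = 2^(P+k) + 2^k + 1`, one quantum above the `X`-MIDPOINT `w = 2^(P+k) + 2^k` of the
  consecutive `X`-values `2^(P+k)` (trailing significand `0`) and `2^(P+k) + 2^(k+1)` (trailing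
  significand `1`; no value of `X` between: `gap_above_pow`);
* `fl_Y t = w` (`toRat_roundNE_wide_above_midpoint`): `w` is a value of `Y` (`q ≥ P + 1`
  significant bits), the next value of `Y` above `w` is at least two quanta away (`q ≤ P + k`),
  so `fl_Y t ∈ {w, w + 2}` and a tie goes to `w` (`4 ∣ w` as `k ≥ 2`: the even significand in `Y`;
  `four_dvd_of_roundNE_tie`);
* `fl_X w = 2^(P+k)` (`toRat_roundNE_midpoint`: the tie goes to the even significand `0`), while
  `fl_X t = 2^(P+k) + 2^(k+1)` (`toRat_roundNE_above_midpoint`: strictly above the midpoint).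
The range hypothesis is exactly what puts `2^(P+k) + 2^(k+1)` inside `X` (in the first regime via
THE GRID ABOVE A POWER OF TWO, `pow_add_pow_le_of_representable`: `M ≥ 2^q₁ + 1` forces
`M ≥ 2^q₁ + 2^(k+1)`).

TWO IMPLEMENTATIONS: A = `code/enum/doubleround_decision.py` (brute force over all operand pairs
for every `(P, q, M)` with `P ≤ 7`, and the 147 replayed witnesses of the named matrix);
B = this file with `DoubleRoundingThreshold.lean` (a proof for all records). With them the four
decision theorems of the cell — D (exact products / sums), D-conv (embeddings), D-rt (round trips),
D-dr (double rounding of sums, clauses (S), (T); clause (W) = [Figueroa1995, §2] needs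
`bias_X ≤ bias_Y` or the phantom-wide device) — are statements about the parameter records, not
about the 13 names. PLACEMENT: [Figueroa1995, §2; Rump2016, Lemma 4.4; Roux2014;
BoldoMelquiond2017, §3.2.2.3] treat unbounded exponent range, where `q ≥ 2P + 1` is necessary and
sufficient; the finite-range threshold and its witnesses in general position were not found in the
held corpus or the galaxy corpora (`DOUBLE-ROUNDING.md` §5).
-/

namespace Summit.Ventures.CertifiedArithmetic

open Literature.ComputerArithmetic.FloatingPoint
open Literature.ComputerArithmetic.FloatingPoint.Format
open Literature.ComputerArithmetic.FloatingPoint.MiniFloat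

/-! ## §1 The failing configuration: one quantum above a midpoint of `φ` -/

/-- A representable magnitude is the value of a datum (natural-number form). -/
theorem exists_toRat_eq_natMul {φ : Format} {n : ℕ} (h : φ.Representable n) :
    ∃ y : MiniFloat φ, y.toRat = (n : ℚ) * φ.quantum := by
  obtain ⟨y, hy⟩ := exists_toRat_eq_intCast_mul (φ := φ) (n : ℤ)
    (by rw [Int.natAbs_natCast]; exact h)
  exact ⟨y, by rw [hy]; push_cast; ring⟩

/-- `2^(P+k)` and `2^(P+k) + 2^(k+1)` — consecutive members of the `P`-bit grid — are values of
`φ` as soon as the latter is within range. -/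
theorem representable_pow_add {φ : Format} {k : ℕ}
    (hu : 2 ^ (φ.manBits + 1 + k) + 2 ^ (k + 1) ≤ φ.maxScaled) :
    φ.Representable (2 ^ (φ.manBits + 1 + k)) ∧
      φ.Representable (2 ^ (φ.manBits + 1 + k) + 2 ^ (k + 1)) := by
  constructor
  · exact representable_of_pow_dvd (g := φ.manBits + 1 + k) dvd_rfl
      (Nat.pow_le_pow_right (by norm_num) (by omega)) (le_trans (Nat.le_add_right _ _) hu)
  · refine representable_of_pow_dvd (g := k + 1) (dvd_add (pow_dvd_pow 2 (by omega)) dvd_rfl) ?_ hu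
    have h2 : 2 ^ (φ.manBits + 1 + (k + 1)) = 2 ^ (φ.manBits + 1 + k) + 2 ^ (φ.manBits + 1 + k) := by
      rw [show φ.manBits + 1 + (k + 1) = (φ.manBits + 1 + k) + 1 by ring, pow_succ]; ring
    rw [h2]
    exact Nat.add_le_add_left (Nat.pow_le_pow_right (by norm_num) (by omega)) _

/-- GAP IN `φ` ABOVE A POWER OF TWO: no value of `φ` lies strictly between `2^(P+k)` and
`2^(P+k) + 2^(k+1)` quanta. -/
theorem gap_above_pow {φ : Format} {k : ℕ} {v0 : MiniFloat φ}
    (hv0 : v0.toRat = ((2 ^ (φ.manBits + 1 + k) : ℕ) : ℚ) * φ.quantum) (y : MiniFloat φ) :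
    y.toRat ≤ ((2 ^ (φ.manBits + 1 + k) : ℕ) : ℚ) * φ.quantum ∨
      ((2 ^ (φ.manBits + 1 + k) + 2 ^ (k + 1) : ℕ) : ℚ) * φ.quantum ≤ y.toRat := by
  rcases le_or_gt y.toRat (((2 ^ (φ.manBits + 1 + k) : ℕ) : ℚ) * φ.quantum) with h | h
  · exact Or.inl h
  right
  have hq := φ.quantum_pos
  have hz0 : 0 ≤ v0.toRat := by rw [hv0]; positivity
  have hS : v0.scaledMag = 2 ^ (φ.manBits + 1 + k) := scaledMag_eq_of_toRat_eq hv0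
  have he : k + 1 ≤ v0.expCode - 1 := succ_le_ulpExp_of_le_scaledMag (k := k) (by rw [hS])
  have h1 := add_ulp_le_of_lt (y := y) hz0 (by rw [hv0]; exact h)
  have h2 : (2 : ℚ) ^ (k + 1) ≤ 2 ^ (v0.expCode - 1) := pow_le_pow_right₀ (by norm_num) he
  calc ((2 ^ (φ.manBits + 1 + k) + 2 ^ (k + 1) : ℕ) : ℚ) * φ.quantum
      = v0.toRat + 2 ^ (k + 1) * φ.quantum := by rw [hv0]; push_cast; ring
    _ ≤ v0.toRat + 2 ^ (v0.expCode - 1) * φ.quantum := by nlinarith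
    _ ≤ y.toRat := h1

/-- THE MIDPOINT GOES DOWN: `fl_φ` of the midpoint `2^(P+k) + 2^k` quanta is `2^(P+k)` quanta
(a tie; the lower neighbour has trailing significand `0`, the upper one `1`; `P ≥ 2`). -/
theorem toRat_roundNE_midpoint {φ : Format} (h1 : 1 ≤ φ.manBits) {k : ℕ}
    (hu : 2 ^ (φ.manBits + 1 + k) + 2 ^ (k + 1) ≤ φ.maxScaled) :
    (roundNE φ (((2 ^ (φ.manBits + 1 + k) + 2 ^ k : ℕ) : ℚ) * φ.quantum)).toRat
      = ((2 ^ (φ.manBits + 1 + k) : ℕ) : ℚ) * φ.quantum := by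
  have hq := φ.quantum_pos
  obtain ⟨hr0, hru⟩ := representable_pow_add hu
  obtain ⟨v0, hv0⟩ := exists_toRat_eq_natMul hr0
  obtain ⟨yu, hyu⟩ := exists_toRat_eq_natMul hru
  set x := ((2 ^ (φ.manBits + 1 + k) + 2 ^ k : ℕ) : ℚ) * φ.quantum with hx
  set T := (2 : ℚ) ^ k * φ.quantum with hT
  have hT0 : 0 < T := by positivity
  have exv : x - v0.toRat = T := by rw [hx, hv0]; push_cast; ring
  have exu : x - yu.toRat = -T := by rw [hx, hyu]; push_cast; ring
  have hnear := roundNE_nearest (φ := φ) x v0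
  rw [exv, abs_of_pos hT0] at hnear
  have hor : (roundNE φ x).toRat = v0.toRat ∨ (roundNE φ x).toRat = yu.toRat := by
    rcases gap_above_pow hv0 (roundNE φ x) with h | h
    · rw [← hv0] at h
      left
      rw [abs_of_nonneg (by linarith)] at hnear
      linarith
    · rw [← hyu] at h
      right
      rw [abs_of_nonpos (by linarith)] at hnear
      linarith
  rcases hor with h | h
  · rw [h, hv0]
  · exfalso
    have hev : 2 ∣ (roundNE φ x).man :=
      roundNE_man_even_of_tie h1 (y := v0) (by rw [h, exv, exu, abs_neg])
        (by rw [h]; intro heq; linarith)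
    rw [two_dvd_man_iff h1] at hev
    have hS : (roundNE φ x).scaledMag = 2 ^ (φ.manBits + 1 + k) + 2 ^ (k + 1) :=
      scaledMag_eq_of_toRat_eq (by rw [h, hyu])
    have he : k + 1 ≤ (roundNE φ x).expCode - 1 :=
      succ_le_ulpExp_of_le_scaledMag (k := k) (by rw [hS]; exact Nat.le_add_right _ _)
    rw [hS] at hev
    obtain ⟨t, ht⟩ := Nat.exists_eq_add_of_le he
    have h3 : 2 ^ (k + 2) ∣ 2 ^ (φ.manBits + 1 + k) + 2 ^ (k + 1) :=
      dvd_trans ⟨2 ^ t, by rw [ht]; ring⟩ hev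
    have h4 : 2 ^ (k + 2) ∣ 2 ^ (φ.manBits + 1 + k) := pow_dvd_pow 2 (by omega)
    have h5 : 2 ^ (k + 2) ∣ 2 ^ (k + 1) := (Nat.dvd_add_right h4).mp h3
    have h6 := Nat.le_of_dvd (by positivity) h5
    have h7 : 2 ^ (k + 1) < 2 ^ (k + 2) := Nat.pow_lt_pow_right (by norm_num) (by omega)
    omega

/-- ONE QUANTUM ABOVE THE MIDPOINT GOES UP: `fl_φ` of `2^(P+k) + 2^k + 1` quanta is
`2^(P+k) + 2^(k+1)` quanta (the unique nearest value). -/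
theorem toRat_roundNE_above_midpoint {φ : Format} {k : ℕ}
    (hu : 2 ^ (φ.manBits + 1 + k) + 2 ^ (k + 1) ≤ φ.maxScaled) :
    (roundNE φ (((2 ^ (φ.manBits + 1 + k) + 2 ^ k + 1 : ℕ) : ℚ) * φ.quantum)).toRat
      = ((2 ^ (φ.manBits + 1 + k) + 2 ^ (k + 1) : ℕ) : ℚ) * φ.quantum := by
  have hq := φ.quantum_pos
  obtain ⟨hr0, hru⟩ := representable_pow_add hu
  obtain ⟨v0, hv0⟩ := exists_toRat_eq_natMul hr0
  obtain ⟨yu, hyu⟩ := exists_toRat_eq_natMul hru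
  rw [← hyu]
  apply toRat_roundNE_eq_of_forall_lt ⟨yu, rfl⟩
  intro y hy
  set x := ((2 ^ (φ.manBits + 1 + k) + 2 ^ k + 1 : ℕ) : ℚ) * φ.quantum with hx
  set T := (2 : ℚ) ^ k * φ.quantum with hT
  have hT1 : φ.quantum ≤ T := by
    rw [hT]; exact le_mul_of_one_le_left hq.le (one_le_pow₀ (by norm_num))
  have exv : x - v0.toRat = T + φ.quantum := by rw [hx, hv0]; push_cast; ring
  have exu : x - yu.toRat = φ.quantum - T := by rw [hx, hyu]; push_cast; ring
  rw [exu, abs_of_nonpos (by linarith)]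
  rcases gap_above_pow hv0 y with h | h
  · rw [← hv0] at h
    rw [abs_of_nonneg (by linarith)]
    linarith
  · rw [← hyu] at h
    have h' : yu.toRat < y.toRat := lt_of_le_of_ne h (Ne.symm hy)
    rw [abs_of_nonpos (by linarith)]
    linarith

/-- THE INTERMEDIATE ROUNDING LANDS ON THE MIDPOINT: if the quantum and range clauses of
`embedsTest φ ψ` hold, `P_φ < P_ψ ≤ P_φ + k` and `k ≥ 2`, then `fl_ψ` of `2^(P+k) + 2^k + 1`
quanta of `φ` is the `φ`-midpoint `2^(P+k) + 2^k`: it is a value of `ψ`, the next value of `ψ`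
above it is at least two quanta of `φ` away, and a tie is resolved towards it (`4 ∣ 2^(P+k) + 2^k`,
the even significand in `ψ`). -/
theorem toRat_roundNE_wide_above_midpoint {φ ψ : Format} (hq : ψ.qexp ≤ φ.qexp)
    (hM : φ.maxScaled * 2 ^ (φ.qexp - ψ.qexp).toNat ≤ ψ.maxScaled) (hP : φ.manBits < ψ.manBits)
    {k : ℕ} (hk : 2 ≤ k) (hk' : ψ.manBits ≤ φ.manBits + k)
    (hu : 2 ^ (φ.manBits + 1 + k) + 2 ^ (k + 1) ≤ φ.maxScaled) :
    (roundNE ψ (((2 ^ (φ.manBits + 1 + k) + 2 ^ k + 1 : ℕ) : ℚ) * φ.quantum)).toRat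
      = ((2 ^ (φ.manBits + 1 + k) + 2 ^ k : ℕ) : ℚ) * φ.quantum := by
  have hqφ := φ.quantum_pos
  have h1ψ : 1 ≤ ψ.manBits := by omega
  have hkk : 2 ^ k ≤ 2 ^ (k + 1) := Nat.pow_le_pow_right (by norm_num) (by omega)
  set w : ℕ := 2 ^ (φ.manBits + 1 + k) + 2 ^ k with hw
  -- `w` is a value of `ψ`: a multiple of `2^k` with `P_φ + 1 ≤ P_ψ` significant bits
  have hwle : w ≤ 2 ^ (ψ.manBits + 1 + k) := by
    have h2 : 2 ^ k ≤ 2 ^ (φ.manBits + 1 + k) := Nat.pow_le_pow_right (by norm_num) (by omega)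
    have h3 : 2 ^ (φ.manBits + 1 + k) + 2 ^ (φ.manBits + 1 + k) = 2 ^ (φ.manBits + 2 + k) := by
      rw [show φ.manBits + 2 + k = (φ.manBits + 1 + k) + 1 by ring, pow_succ]; ring
    have h4 : 2 ^ (φ.manBits + 2 + k) ≤ 2 ^ (ψ.manBits + 1 + k) :=
      Nat.pow_le_pow_right (by norm_num) (by omega)
    omega
  obtain ⟨zL, hzL⟩ := exists_toRat_eq_natMul_of_dvd hq hM (g := k) (n := w)
    (dvd_add (pow_dvd_pow 2 (by omega)) dvd_rfl) hwle (by omega)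
  have hL : 2 ^ (ψ.manBits + 1) ≤ w :=
    le_trans (Nat.pow_le_pow_right (by norm_num) (by omega)) (Nat.le_add_right _ _)
  have hcast : ((2 ^ (φ.manBits + 1 + k) + 2 ^ k + 1 : ℕ) : ℚ) = (w : ℚ) + 1 := by
    rw [hw]; push_cast; ring
  rw [hcast]
  rcases toRat_roundNE_tie_or hq hzL hL with h | h
  · exact h
  · exfalso
    have hK : (roundNE ψ (((w : ℚ) + 1) * φ.quantum)).toRat = ((w + 2 : ℕ) : ℚ) * φ.quantum := by
      rw [h]; push_cast; ring
    have h4 := four_dvd_of_roundNE_tie h1ψ hq hK (by omega) (y := zL)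
      (by rw [hzL, h, show ((w : ℚ) + 1) * φ.quantum - (w : ℚ) * φ.quantum = φ.quantum by ring,
            show ((w : ℚ) + 1) * φ.quantum - ((w : ℚ) + 2) * φ.quantum = -φ.quantum by ring,
            abs_neg])
      (by rw [hzL, h]; intro heq; have := mul_right_cancel₀ hqφ.ne' heq; linarith)
    have h4w : 4 ∣ w := by
      rw [show (4 : ℕ) = 2 ^ 2 by norm_num, hw]
      exact dvd_add (pow_dvd_pow 2 (by omega)) (pow_dvd_pow 2 hk)
    omega

/-- THE FAILING SUM: under the hypotheses of `toRat_roundNE_wide_above_midpoint` and `P_φ ≥ 2`,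
`t = (2^(P+k) + 2^k + 1) · quantum φ` double-rounds to `2^(P+k)` but rounds to
`2^(P+k) + 2^(k+1)` quanta. -/
theorem roundNE_roundNE_ne_above_midpoint {φ ψ : Format} (hq : ψ.qexp ≤ φ.qexp)
    (hM : φ.maxScaled * 2 ^ (φ.qexp - ψ.qexp).toNat ≤ ψ.maxScaled) (h1 : 1 ≤ φ.manBits)
    (hP : φ.manBits < ψ.manBits) {k : ℕ} (hk : 2 ≤ k) (hk' : ψ.manBits ≤ φ.manBits + k)
    (hu : 2 ^ (φ.manBits + 1 + k) + 2 ^ (k + 1) ≤ φ.maxScaled) :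
    (roundNE φ (roundNE ψ
        (((2 ^ (φ.manBits + 1 + k) + 2 ^ k + 1 : ℕ) : ℚ) * φ.quantum)).toRat).toRat
      ≠ (roundNE φ (((2 ^ (φ.manBits + 1 + k) + 2 ^ k + 1 : ℕ) : ℚ) * φ.quantum)).toRat := by
  rw [toRat_roundNE_wide_above_midpoint hq hM hP hk hk' hu, toRat_roundNE_midpoint h1 hu,
    toRat_roundNE_above_midpoint hu]
  have hq0 := φ.quantum_pos
  intro h
  have h' := mul_right_cancel₀ hq0.ne' h
  have h'' : (2 ^ (φ.manBits + 1 + k) : ℕ) = 2 ^ (φ.manBits + 1 + k) + 2 ^ (k + 1) := by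
    exact_mod_cast h'
  have : 0 < 2 ^ (k + 1) := by positivity
  omega

/-! ## §2 Necessity of the threshold, and clause (T) as an equivalence -/

/-- THEOREM D-dr, CLAUSE (T), NECESSITY — for EVERY pair of format records: if `F_φ ⊆ F_ψ`
(`embedsTest`), `P_φ ≥ 2`, `P_φ < P_ψ ≤ 2 P_φ` and `drThreshold φ ψ ≤ maxScaled φ`, then some
sum of two `φ`-data is double-rounded wrongly: in quanta of `φ`, `a = 2^q₁`, `b = 2^(q₁-P) + 1`
in the regime `q₁ ≤ 2P - 1`, `a = 2^(2P) + 2^(P+1)`, `b = -(2^P - 1)` in the regime `q₁ = 2P`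
(the operands `drWitA`, `drWitB` of the named matrix). -/
theorem not_drAdd_of_threshold_le {φ ψ : Format} (hE : embedsTest φ ψ = true)
    (h1 : 1 ≤ φ.manBits) (hP : φ.manBits < ψ.manBits) (h2P : ψ.manBits ≤ 2 * φ.manBits + 1)
    (hle : drThreshold φ ψ ≤ φ.maxScaled) : ¬ DRAdd φ ψ := by
  have hE' := hE
  simp only [embedsTest, Bool.and_eq_true, decide_eq_true_eq] at hE'
  obtain ⟨⟨-, hq⟩, hM⟩ := hE'
  intro hD
  unfold drThreshold drQ1 at hle
  split at hle
  · -- regime `q₁ ≤ 2P - 1`: `k = q₁ - P`, `a = 2^(P+k)`, `b = 2^k + 1`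
    rename_i hc
    obtain ⟨k, hk⟩ : ∃ k, max (ψ.manBits + 1) (φ.manBits + 3) = φ.manBits + 1 + k :=
      ⟨max (ψ.manBits + 1) (φ.manBits + 3) - (φ.manBits + 1), by omega⟩
    rw [hk] at hle hc
    have hk2 : 2 ≤ k := by omega
    have hk' : ψ.manBits ≤ φ.manBits + k := by omega
    have hkm : k ≤ φ.manBits := by omega
    have hu : 2 ^ (φ.manBits + 1 + k) + 2 ^ (k + 1) ≤ φ.maxScaled :=
      pow_add_pow_le_of_representable (representable_maxScaled φ) (by omega)
    obtain ⟨hr0, -⟩ := representable_pow_add hu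
    obtain ⟨a, ha⟩ := exists_toRat_eq_natMul hr0
    have hb_lt : 2 ^ k + 1 < 2 ^ (φ.manBits + 1) := by
      have h2 : 2 ^ k ≤ 2 ^ φ.manBits := Nat.pow_le_pow_right (by norm_num) hkm
      have h3 : 2 ^ 1 ≤ 2 ^ φ.manBits := Nat.pow_le_pow_right (by norm_num) h1
      have h4 : 2 ^ (φ.manBits + 1) = 2 * 2 ^ φ.manBits := by rw [pow_succ]; ring
      norm_num at h3
      omega
    have hkk : 2 ^ k ≤ 2 ^ (k + 1) := Nat.pow_le_pow_right (by norm_num) (by omega)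
    have hpos : 0 < 2 ^ (φ.manBits + 1 + k) := by positivity
    have hb_le : 2 ^ k + 1 ≤ φ.maxScaled := by omega
    obtain ⟨b, hb⟩ := exists_toRat_eq_natMul (φ := φ) (n := 2 ^ k + 1)
      (representable_of_lt_pow hb_lt hb_le)
    have hsum : a.toRat + b.toRat
        = ((2 ^ (φ.manBits + 1 + k) + 2 ^ k + 1 : ℕ) : ℚ) * φ.quantum := by
      rw [ha, hb]; push_cast; ring
    have h := hD a b
    rw [hsum] at h
    exact roundNE_roundNE_ne_above_midpoint hq hM h1 hP hk2 hk' hu h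
  · -- regime `q₁ = 2P`: `k = P`, `a = 2^(2P) + 2^(P+1)`, `b = -(2^P - 1)`
    have hu : 2 ^ (φ.manBits + 1 + (φ.manBits + 1)) + 2 ^ (φ.manBits + 1 + 1) ≤ φ.maxScaled := by
      rw [show φ.manBits + 1 + (φ.manBits + 1) = 2 * φ.manBits + 2 by ring,
        show φ.manBits + 1 + 1 = φ.manBits + 2 by ring]
      exact hle
    obtain ⟨-, hru⟩ := representable_pow_add hu
    obtain ⟨a, ha⟩ := exists_toRat_eq_natMul hru
    have hb_lt : 2 ^ (φ.manBits + 1) - 1 < 2 ^ (φ.manBits + 1) := Nat.sub_lt (by positivity) one_pos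
    have hkk : 2 ^ (φ.manBits + 1) ≤ 2 ^ (φ.manBits + 1 + 1) :=
      Nat.pow_le_pow_right (by norm_num) (by omega)
    have hpos : 0 < 2 ^ (φ.manBits + 1 + (φ.manBits + 1)) := by positivity
    have hb_le : 2 ^ (φ.manBits + 1) - 1 ≤ φ.maxScaled := by omega
    obtain ⟨b, hb⟩ := exists_toRat_eq_intCast_mul (φ := φ) (-((2 ^ (φ.manBits + 1) - 1 : ℕ) : ℤ))
      (by rw [Int.natAbs_neg, Int.natAbs_natCast]; exact representable_of_lt_pow hb_lt hb_le)
    have h1le : 1 ≤ 2 ^ (φ.manBits + 1) := Nat.one_le_two_pow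
    have hsum : a.toRat + b.toRat = ((2 ^ (φ.manBits + 1 + (φ.manBits + 1))
        + 2 ^ (φ.manBits + 1) + 1 : ℕ) : ℚ) * φ.quantum := by
      rw [ha, hb]; push_cast [Nat.cast_sub h1le]; ring
    have h := hD a b
    rw [hsum] at h
    exact roundNE_roundNE_ne_above_midpoint hq hM h1 hP (k := φ.manBits + 1) (by omega) (by omega)
      hu h

/-- THEOREM D-dr, CLAUSE (T), AS AN EQUIVALENCE for every pair of format records with
`F_φ ⊆ F_ψ`, `P_φ ≥ 2`, `P_φ < P_ψ ≤ 2 P_φ`: innocuous double rounding of sums `↔`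
`maxScaled φ < drThreshold φ ψ`. -/
theorem drAdd_iff_lt_threshold {φ ψ : Format} (hE : embedsTest φ ψ = true) (h1 : 1 ≤ φ.manBits)
    (hP : φ.manBits < ψ.manBits) (h2P : ψ.manBits ≤ 2 * φ.manBits + 1) :
    DRAdd φ ψ ↔ φ.maxScaled < drThreshold φ ψ :=
  ⟨fun h => not_le.mp fun hle => not_drAdd_of_threshold_le hE h1 hP h2P hle h,
    drAdd_of_lt_threshold hE h1 hP⟩

/-- The same through the Boolean test of the named matrix: on the strip `P_φ < P_ψ ≤ 2 P_φ` with
`F_φ ⊆ F_ψ` and `P_φ ≥ 2`, `DRAdd φ ψ ↔ drAddTest φ ψ` for every pair of records. -/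
theorem drAdd_iff_test_of_lt {φ ψ : Format} (hE : embedsTest φ ψ = true) (h1 : 1 ≤ φ.manBits)
    (hP : φ.manBits < ψ.manBits) (h2P : ψ.manBits ≤ 2 * φ.manBits + 1) :
    DRAdd φ ψ ↔ drAddTest φ ψ = true := by
  rw [drAdd_iff_lt_threshold hE h1 hP h2P]
  simp only [drAddTest, hE, Bool.true_and, Bool.or_eq_true, beq_iff_eq, decide_eq_true_eq]
  omega

/-- The equivalence under the cell's operand hypothesis `stdOperand φ`. -/
theorem drAdd_iff_lt_threshold_std {φ ψ : Format} (hstd : stdOperand φ = true)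
    (hE : embedsTest φ ψ = true) (hP : φ.manBits < ψ.manBits)
    (h2P : ψ.manBits ≤ 2 * φ.manBits + 1) : DRAdd φ ψ ↔ φ.maxScaled < drThreshold φ ψ := by
  simp only [stdOperand, Bool.and_eq_true, decide_eq_true_eq] at hstd
  exact drAdd_iff_lt_threshold hE hstd.1 hP h2P

/-- THEOREM D-dr FOR EMBEDDED PAIRS OF ARBITRARY RECORDS: if `F_φ ⊆ F_ψ` (`embedsTest`), `P_φ ≥ 2`
and `bias_φ ≤ bias_ψ` (used only above the strip, through the wide clause (W) =
`drAdd_of_wide`, the lean seat's Figueroa theorem), then `DRAdd φ ψ ↔ drAddTest φ ψ`: clause (S)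
for `P_ψ = P_φ`, clause (T) on the strip `P_φ < P_ψ ≤ 2 P_φ`, clause (W) above it. -/
theorem drAdd_iff_test_of_embedsTest {φ ψ : Format} (hE : embedsTest φ ψ = true)
    (h1 : 1 ≤ φ.manBits) (hb : φ.bias ≤ ψ.bias) : DRAdd φ ψ ↔ drAddTest φ ψ = true := by
  have hE' := hE
  simp only [embedsTest, Bool.and_eq_true, decide_eq_true_eq] at hE'
  obtain ⟨⟨hmm, hq⟩, hM⟩ := hE'
  have hmax : φ.maxRat ≤ ψ.maxRat := (maxRat_le_maxRat_iff hq).2 hM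
  rcases Nat.lt_or_ge φ.manBits ψ.manBits with hlt | hge
  · rcases Nat.lt_or_ge ψ.manBits (2 * φ.manBits + 2) with h2 | h2
    · exact drAdd_iff_test_of_lt hE h1 hlt (by omega)
    · refine ⟨fun _ => ?_, fun _ => drAdd_of_wide h2 hb hmax⟩
      simp only [drAddTest, hE, Bool.true_and, Bool.or_eq_true, beq_iff_eq, decide_eq_true_eq]
      omega
  · have hm : φ.manBits = ψ.manBits := le_antisymm hmm hge
    refine ⟨fun _ => ?_, fun _ => drAdd_of_manBits_eq hm h1 hq hmax⟩
    simp only [drAddTest, hE, Bool.true_and, Bool.or_eq_true, beq_iff_eq, decide_eq_true_eq]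
    omega

/-! ## §3 Scope: the embedding hypothesis, and the named failing cells -/

/-- THE EMBEDDING HYPOTHESIS CANNOT BE DROPPED: the phantom-top pair of `RoundTripDecision.lean`
lies on the strip (`P = 2 < q = 3 ≤ 2P`) and double rounding of sums through the wide record IS
innocuous (`8 ↦ 7 ↦ 8` by saturation and the tie at `7`, whose even side in the narrow record is
`8`; every other sum of magnitude `≤ 7` is a value of the wide record; kernel exhaustion of the
`16²` operand pairs), yet the narrow record does not embed and the Boolean test answers `false`.
So `DRAdd ↔ drAddTest` is a theorem about embedded pairs (above) and about the named records
(`drAdd_named_iff_test`), not about all pairs of records. -/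
theorem phantom_drAdd_not_test :
    DRAdd PhantomNarrow PhantomWide ∧ ¬ Embeds PhantomNarrow PhantomWide ∧
      drAddTest PhantomNarrow PhantomWide = false :=
  ⟨drAdd_of_all (by decide +kernel), phantom_roundTrips_not_embeds.2, by decide⟩

/-- READING: the failing clause-(T) cells of the named matrix by the general theorem, no witness
replay — e3m2 through e4m3 (`q = P + 1`, `448 ≥ 33`), e4m3 through bfloat16 (`q = 2P`,
`229376 ≥ 288`), binary8p5 through bfloat16 (`q = 8`, `1920 ≥ 257`). -/
theorem not_drAdd_T_cells_by_threshold :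
    ¬ DRAdd E3M2 E4M3 ∧ ¬ DRAdd E4M3 BFloat16 ∧ ¬ DRAdd Binary8p5 BFloat16 :=
  ⟨not_drAdd_of_threshold_le (by decide +kernel) (by decide) (by decide) (by decide)
      (by decide +kernel),
    not_drAdd_of_threshold_le (by decide +kernel) (by decide) (by decide) (by decide)
      (by decide +kernel),
    not_drAdd_of_threshold_le (by decide +kernel) (by decide) (by decide) (by decide)
      (by decide +kernel)⟩

end Summit.Ventures.CertifiedArithmetic
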